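import Mathlib
import Literature.NumberTheory.LFunctions.WeilOddGroundState
import Summits.RiemannHypothesis.RiemannHypothesis.Theorems.GroundBartaEvenWinsBeyondArchCellsUpTo75
import Summits.RiemannHypothesis.RiemannHypothesis.Theorems.GroundBartaEvenWinsBeyondArchUpper75
import Summits.RiemannHypothesis.RiemannHypothesis.Theorems.WeilGroundStateGroundStateSimpleEvenCellTransfer
import HarnessLib

/-!
# The parity ladder beyond `log 2`: the WIDE cell `[3/4, 39/50]` from one odd-sector lower bound at `39/50`

Route WeilParity item `NoParityCrossing` (stmt-RiemannHypothesis-18085) ≡ GroundBarta rung 4 (stmt-RiemannHypothesis-18807).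
Pure logic, RH-free.  Prover A (gen 4 of unit `sr-gb-rung-a`).

Why a wide cell.  Prover B's certified residual norms of the degree-55 Ritz vectors satisfy `s_i/ρ_i ≈ 0.06 / 0.085 / 0.11`
at `b = 0.72 / 0.75 / 0.77` for the three low odd modes alike, so the sigma criterion of the deflated Temple L-side totals
`≈ (K/β)·(2 + 1/(1 − λ/ρ₀))` with `K = s/ρ`: the cell length enters only through `λ/ρ₀`, and a cell `[3/4, 39/50]` costs a
factor `≈ 4.2` instead of `≈ 3` — cheaper than two cell pipelines `[3/4, 77/100]`, `[77/100, 39/50]`.  The right end `39/50`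
is also the reach of the present two-prime moment format (`κ(a₀) < 0` from `a₀ ≈ 0.787`, chain T120, `N = 255`).

With the landed U-side `trialUpper75 : ε(3/4) ≤ 1/(14·10¹²)` the cell transfer reduces `[3/4, 39/50]` to
`1/(14·10¹²) < L ≤ ε_od(39/50)`; chained with `weilWindowSimpleEven_upTo_M75` (cells `[2/3,18/25]`, `[18/25,3/4]` closed in
the tree): `WeilWindowSimpleEven` on `(0, 39/50]` from that single lower bound.
-/

set_option linter.dupNamespace false

noncomputable section

open Set MeasureTheory

namespace Summit.RiemannHypothesis.RiemannHypothesis.Theorems.EvenWinsBeyondArch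

open Literature.NumberTheory.LFunctions

/-- **The wide cell `[3/4, 39/50]`**: `1/(14·10¹²) < L ≤ ε_od(39/50) ⟹ WeilWindowSimpleEven a` for `a ∈ [3/4, 39/50]`
(U-side `trialUpper75`, monotonicity of both sector bottoms in the window). [folklore] -/
theorem weilWindowSimpleEven_on_wideCell_M78_of_oddLower {L : ℝ} (hUL : (1 / 14000000000000 : ℝ) < L)
    (hL : L ≤ weilOddGroundEnergy (39 / 50 : ℝ)) {a : ℝ} (hlo : (3 / 4 : ℝ) ≤ a) (hhi : a ≤ 39 / 50) :
    WeilWindowSimpleEven a :=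
  GroundStateSimpleEven.weilWindowSimpleEven_on_cell_of_le (b := (3 / 4 : ℝ)) (c := (39 / 50 : ℝ)) (by norm_num) hUL
    trialUpper75 (fun _ hg hs hn ho ↦ hL.trans (weilOddGroundEnergy_le hg hs ho hn)) hlo hhi

/-- **`WeilWindowSimpleEven` on `(0, 39/50]` from ONE odd-sector lower bound at `39/50`** (the first two cells are
closed in the tree: `weilWindowSimpleEven_upTo_M75`). [folklore] -/
theorem weilWindowSimpleEven_upTo_M78_of_oddLower {L : ℝ} (hUL : (1 / 14000000000000 : ℝ) < L)
    (hL : L ≤ weilOddGroundEnergy (39 / 50 : ℝ)) :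
    ∀ a : ℝ, 0 < a → a ≤ 39 / 50 → WeilWindowSimpleEven a := by
  intro a ha hle
  rcases le_or_gt a (3 / 4) with h | h
  · exact weilWindowSimpleEven_upTo_M75 a ha h
  · exact weilWindowSimpleEven_on_wideCell_M78_of_oddLower hUL hL h.le hle

/-- The tail shape of item 18085 up to `39/50` from the same single lower bound:
`log 2 < a ≤ 39/50 ⟹ WeilWindowSimpleEven a`. [folklore] -/
theorem tailSimpleEven_upTo_M78_of_oddLower {L : ℝ} (hUL : (1 / 14000000000000 : ℝ) < L)
    (hL : L ≤ weilOddGroundEnergy (39 / 50 : ℝ)) :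
    ∀ a : ℝ, Real.log 2 < a → a ≤ 39 / 50 → WeilWindowSimpleEven a :=
  fun a ha hle ↦ weilWindowSimpleEven_upTo_M78_of_oddLower hUL hL a ((Real.log_pos (by norm_num)).trans ha) hle

end Summit.RiemannHypothesis.RiemannHypothesis.Theorems.EvenWinsBeyondArch

end
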